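import Summits.AtomisticToContinuum.HydrodynamicLimit.Theorems.AnnealedZeroHorizonMeanFluxClosureCollisionalVirialClosureB
import HarnessLib

/-!
# Stub VIRIAL `stub_collisionalVirialClosure` of crux `MeanFluxClosure`
# (stmt-AtomisticToContinuum-9256, route AnnealedZeroHorizon, line `registered`): part C —
# at CONSTANT profiles stub VIRIAL is EQUIVALENT to the mean closure of `J_φ − I_φ` alone

Bookkeeping on top of `…CollisionalVirialClosureB` (`stub_collisionalVirialEquilibriumStress`: in equilibrium the
collisional stress summand `c · collisionalStress (Dφ) ∘ Φ_{t₁}` of stub VIRIAL is integrable with mean EXACTLY `0`,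
for every `N`). Write `VIRIAL-const` for the stub's signature specialised to constant profiles `a₀ ≡ a > 0`,
`u₀ ≡ u`, `θ₀ ≡ θ > 0` (law `localGibbsLaw σ (fun _ => a) (fun _ => u) (fun _ => θ) N (Φ N)`), and `JI-const` for the
same statement with the functional `D = J_φ − I_φ` ALONE (`J_φ`, `I_φ` the stub's two `∫_{t₁}^{t₂} ∫_{𝕋³}` integrals of
the ideal, resp. full — `hsPressure` — Euler stress of the mollified empirical fields, verbatim). Then

* `stub_collisionalVirialStressAbsorbConst` (registered sub-goal of stmt-AtomisticToContinuum-9256): for EVERY functional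
  `F`, `F` is integrable with `|mean| ≤ ε` iff `c · collisionalStress (Dφ) ∘ Φ_{t₁} + F` is (the summand has mean `0`);
* `collisionalVirialClosureConst_of_idealFullEulerStressClosureConst`: `JI-const → VIRIAL-const`;
* `idealFullEulerStressClosureConst_of_collisionalVirialClosureConst`: `VIRIAL-const → JI-const`.

So the residual content of stub VIRIAL in equilibrium is exactly `JI-const`: the mean closure of the EXCESS pressure
term `∫∫ (hsPressure σ R Θ − R Θ) div φ` of the mollified fields — the equation-of-state obstruction (`Integrable` of
`hsPressure` at the uncontrolled window packing; see the skeleton docstring), untouched here.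
-/

noncomputable section

namespace Summit.AtomisticToContinuum.HydrodynamicLimit.Theorems

open MeasureTheory Set Filter
open Literature.MathematicalPhysics.KineticTheory Literature.Analysis.FluidPDE Literature.Analysis.FunctionSpaces

namespace CollisionalVirialClosure

/-- Abstract assembly: if `S` is integrable with mean `0` and `J − I` is integrable with `|mean| ≤ ε`, then
`S + J − I` is integrable with `|mean| ≤ ε`. [folklore] -/
theorem integrable_and_abs_integral_le_of_add_sub {α : Type*} [MeasurableSpace α] {μ : Measure α}
    {S J I : α → ℝ} {ε : ℝ} (hS : Integrable S μ ∧ ∫ z, S z ∂μ = 0)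
    (hJI : Integrable (fun z => J z - I z) μ ∧ |∫ z, (J z - I z) ∂μ| ≤ ε) :
    Integrable (fun z => S z + J z - I z) μ ∧ |∫ z, (S z + J z - I z) ∂μ| ≤ ε := by
  have he : (fun z => S z + J z - I z) = fun z => S z + (J z - I z) := funext fun z => add_sub_assoc _ _ _
  rw [he]
  refine ⟨hS.1.add hJI.1, ?_⟩
  rw [integral_add hS.1 hJI.1, hS.2, zero_add]
  exact hJI.2

/-- Abstract disassembly: if `S` is integrable with mean `0` and `S + J − I` is integrable with `|mean| ≤ ε`, then
`J − I` is integrable with `|mean| ≤ ε`. [folklore] -/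
theorem integrable_and_abs_integral_le_sub_of_add_sub {α : Type*} [MeasurableSpace α] {μ : Measure α}
    {S J I : α → ℝ} {ε : ℝ} (hS : Integrable S μ ∧ ∫ z, S z ∂μ = 0)
    (hD : Integrable (fun z => S z + J z - I z) μ ∧ |∫ z, (S z + J z - I z) ∂μ| ≤ ε) :
    Integrable (fun z => J z - I z) μ ∧ |∫ z, (J z - I z) ∂μ| ≤ ε := by
  have he : (fun z => J z - I z) = fun z => (S z + J z - I z) - S z := funext fun z => by ring
  rw [he]
  refine ⟨hD.1.sub hS.1, ?_⟩
  rw [integral_sub hD.1 hS.1, hS.2, sub_zero]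
  exact hD.2

end CollisionalVirialClosure

open CollisionalVirialClosure in
/-- **Registered sub-goal `stub_collisionalVirialStressAbsorbConst` of stmt-AtomisticToContinuum-9256 (stub VIRIAL at constant
profiles, absorption of the collisional-stress summand).** In equilibrium (`a, θ > 0`, `u`; `0 < σ < 1/2`; every `N`, flow,
`0 ≤ t₁ ≤ t₂`, smooth `φ`), for EVERY functional `F` and every `ε`: `F` is integrable under the local Gibbs law with
`|mean| ≤ ε` if and only if `c · collisionalStress (Dφ) ∘ Φ_{t₁} + F` is — the collisional-stress summand of stub VIRIAL
is integrable with mean exactly `0` (`stub_collisionalVirialEquilibriumStress`), so it can be freely added or removed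
(apply with `F = J_φ − I_φ`). [folklore] -/
theorem stub_collisionalVirialStressAbsorbConst : ∀ (a θ : ℝ) (u : Literature.MathematicalPhysics.KineticTheory.V3), 0 < a → 0 < θ → ∀ (σ : ℝ), 0 < σ → σ < 1 / 2 → ∀ (N : ℕ) (Φ : Literature.Analysis.FluidPDE.HardSphereFlow (Literature.Analysis.FluidPDE.Torus.geometry (Fin 3)) (Literature.MathematicalPhysics.KineticTheory.hsDiameter σ N) (N + 1)) (t₁ t₂ : ℝ), 0 ≤ t₁ → t₁ ≤ t₂ → ∀ (φ : Literature.MathematicalPhysics.KineticTheory.T3 → Literature.MathematicalPhysics.KineticTheory.V3), Literature.Analysis.FunctionSpaces.Torus.IsSmooth φ → ∀ (ε : ℝ) (F : Literature.Analysis.FluidPDE.Config (N + 1) (Fin 3) Literature.MathematicalPhysics.KineticTheory.T3 → ℝ), (MeasureTheory.Integrable F (Literature.MathematicalPhysics.KineticTheory.localGibbsLaw σ (fun _ => a) (fun _ => u) (fun _ => θ) N Φ) ∧ |∫ z, F z ∂Literature.MathematicalPhysics.KineticTheory.localGibbsLaw σ (fun _ => a) (fun _ => u) (fun _ => θ) N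 Φ| ≤ ε) ↔ (MeasureTheory.Integrable (fun z => ((N + 1 : ℕ) : ℝ)⁻¹ * Φ.collisionalStress (Literature.Analysis.FunctionSpaces.Torus.fderiv φ) (Φ.flow t₁ z) (t₂ - t₁) + F z) (Literature.MathematicalPhysics.KineticTheory.localGibbsLaw σ (fun _ => a) (fun _ => u) (fun _ => θ) N Φ) ∧ |∫ z, (((N + 1 : ℕ) : ℝ)⁻¹ * Φ.collisionalStress (Literature.Analysis.FunctionSpaces.Torus.fderiv φ) (Φ.flow t₁ z) (t₂ - t₁) + F z) ∂Literature.MathematicalPhysics.KineticTheory.localGibbsLaw σ (fun _ => a) (fun _ => u) (fun _ => θ) N Φ| ≤ ε) := by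
  intro a θ u ha hθ σ hσ hσ₂ N Φ t₁ t₂ h₁ h₁₂ φ hφ ε F
  obtain ⟨hS, -, -⟩ := stub_collisionalVirialEquilibriumStress a θ u ha hθ σ hσ hσ₂ N Φ t₁ t₂ h₁ h₁₂ φ hφ
  constructor
  · intro hF
    simpa only [sub_zero] using
      integrable_and_abs_integral_le_of_add_sub (J := F) (I := fun _ => (0 : ℝ)) hS (by simpa only [sub_zero] using hF)
  · intro hD
    simpa only [sub_zero] using
      integrable_and_abs_integral_le_sub_of_add_sub (J := F) (I := fun _ => (0 : ℝ)) hS (by simpa only [sub_zero] using hD)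

open CollisionalVirialClosure in
/-- **Reduction at constant profiles: `JI-const → VIRIAL-const`.** If, in equilibrium (`a, θ > 0`, `u`; `σ` below a threshold; any flow family;
`0 ≤ t₁ ≤ t₂`; `ε > 0`; smooth `φ`; kernels `k` at a scale `ℓ`), eventually in `N` the functional `J_φ − I_φ` (ideal minus
full Euler stress of the mollified fields, time-integrated, verbatim from the stub) is integrable under the local Gibbs
law with `|mean| ≤ ε`, then stub VIRIAL holds at constant profiles: its collisional-stress summand is integrable with
mean exactly `0` for every `N` (`stub_collisionalVirialEquilibriumStress`; threshold `min σ₀ (1/2)`). [folklore] -/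
theorem collisionalVirialClosureConst_of_idealFullEulerStressClosureConst : (∀ (a θ : ℝ) (u : Literature.MathematicalPhysics.KineticTheory.V3), 0 < a → 0 < θ → ∃ σ₀ : ℝ, 0 < σ₀ ∧ ∀ σ : ℝ, 0 < σ → σ < σ₀ → ∀ Φ : (N : ℕ) → Literature.Analysis.FluidPDE.HardSphereFlow (Literature.Analysis.FluidPDE.Torus.geometry (Fin 3)) (Literature.MathematicalPhysics.KineticTheory.hsDiameter σ N) (N + 1), ∀ t₁ t₂ : ℝ, 0 ≤ t₁ → t₁ ≤ t₂ → ∀ ε : ℝ, 0 < ε → (∀ φ : Literature.MathematicalPhysics.KineticTheory.T3 → Literature.MathematicalPhysics.KineticTheory.V3, Literature.Analysis.FunctionSpaces.Torus.IsSmooth φ → ∃ ℓ : ℝ, 0 < ℓ ∧ ∀ k : Literature.MathematicalPhysics.KineticTheory.T3 → ℝ, (Continuous k ∧ (∀ y, 0 ≤ k y) ∧ (∫ y, k y = 1) ∧ (∀ y, k y ≠ 0 → Literature.Analysis.FluidPDE.Torus.euclidDist y 0 < ℓ)) → ∀ᶠ N in Filter.atTop, ∀ D : Literature.Analysis.FluidPDE.Config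 (N + 1) (Fin 3) Literature.MathematicalPhysics.KineticTheory.T3 → ℝ, D = (fun z => (∫ s in t₁..t₂, ∫ x, ((∑ i, ∑ j, (Literature.MathematicalPhysics.KineticTheory.empiricalMomentumField ((Φ N).flow s z) (fun y => k (x - y)) i * Literature.MathematicalPhysics.KineticTheory.empiricalMomentumField ((Φ N).flow s z) (fun y => k (x - y)) j / Literature.MathematicalPhysics.KineticTheory.empiricalDensityField ((Φ N).flow s z) (fun y => k (x - y))) * Literature.Analysis.FunctionSpaces.Torus.partialDeriv j (fun y => φ y i) x) + Literature.MathematicalPhysics.KineticTheory.empiricalDensityField ((Φ N).flow s z) (fun y => k (x - y)) * (2 / 3 * (Literature.MathematicalPhysics.KineticTheory.empiricalEnergyField ((Φ N).flow s z) (fun y => k (x - y)) / Literature.MathematicalPhysics.KineticTheory.empiricalDensityField ((Φ N).flow s z) (fun y => k (x - y)) - ‖Literature.MathematicalPhysics.KineticTheory.empiricalMomentumField ((Φ N).flow s z) (fun y => k (x - y))‖ ^ 2 / (2 * Literature.MathematicalPhysics.KineticTheory.empiricalDensityField ((Φ N).flow s z) (fun y => k (x - y)) ^ 2))) * Literature.Analysis.FunctionSpaces.Torus.divergence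 φ x)) - (∫ s in t₁..t₂, ∫ x, ((∑ i, ∑ j, (Literature.MathematicalPhysics.KineticTheory.empiricalMomentumField ((Φ N).flow s z) (fun y => k (x - y)) i * Literature.MathematicalPhysics.KineticTheory.empiricalMomentumField ((Φ N).flow s z) (fun y => k (x - y)) j / Literature.MathematicalPhysics.KineticTheory.empiricalDensityField ((Φ N).flow s z) (fun y => k (x - y))) * Literature.Analysis.FunctionSpaces.Torus.partialDeriv j (fun y => φ y i) x) + Literature.MathematicalPhysics.KineticTheory.hsPressure σ (Literature.MathematicalPhysics.KineticTheory.empiricalDensityField ((Φ N).flow s z) (fun y => k (x - y))) (2 / 3 * (Literature.MathematicalPhysics.KineticTheory.empiricalEnergyField ((Φ N).flow s z) (fun y => k (x - y)) / Literature.MathematicalPhysics.KineticTheory.empiricalDensityField ((Φ N).flow s z) (fun y => k (x - y)) - ‖Literature.MathematicalPhysics.KineticTheory.empiricalMomentumField ((Φ N).flow s z) (fun y => k (x - y))‖ ^ 2 / (2 * Literature.MathematicalPhysics.KineticTheory.empiricalDensityField ((Φ N).flow s z) (fun y => k (x - y)) ^ 2))) * Literature.Analysis.FunctionSpaces.Torus.divergence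 φ x))) → MeasureTheory.Integrable D (Literature.MathematicalPhysics.KineticTheory.localGibbsLaw σ (fun _ => a) (fun _ => u) (fun _ => θ) N (Φ N)) ∧ |∫ z, D z ∂Literature.MathematicalPhysics.KineticTheory.localGibbsLaw σ (fun _ => a) (fun _ => u) (fun _ => θ) N (Φ N)| ≤ ε)) → ∀ (a θ : ℝ) (u : Literature.MathematicalPhysics.KineticTheory.V3), 0 < a → 0 < θ → ∃ σ₀ : ℝ, 0 < σ₀ ∧ ∀ σ : ℝ, 0 < σ → σ < σ₀ → ∀ Φ : (N : ℕ) → Literature.Analysis.FluidPDE.HardSphereFlow (Literature.Analysis.FluidPDE.Torus.geometry (Fin 3)) (Literature.MathematicalPhysics.KineticTheory.hsDiameter σ N) (N + 1), ∀ t₁ t₂ : ℝ, 0 ≤ t₁ → t₁ ≤ t₂ → ∀ ε : ℝ, 0 < ε → (∀ φ : Literature.MathematicalPhysics.KineticTheory.T3 → Literature.MathematicalPhysics.KineticTheory.V3, Literature.Analysis.FunctionSpaces.Torus.IsSmooth φ → ∃ ℓ : ℝ, 0 < ℓ ∧ ∀ k : Literature.MathematicalPhysics.KineticTheory.T3 →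 ℝ, (Continuous k ∧ (∀ y, 0 ≤ k y) ∧ (∫ y, k y = 1) ∧ (∀ y, k y ≠ 0 → Literature.Analysis.FluidPDE.Torus.euclidDist y 0 < ℓ)) → ∀ᶠ N in Filter.atTop, ∀ D : Literature.Analysis.FluidPDE.Config (N + 1) (Fin 3) Literature.MathematicalPhysics.KineticTheory.T3 → ℝ, D = (fun z => ((N + 1 : ℕ) : ℝ)⁻¹ * (Φ N).collisionalStress (Literature.Analysis.FunctionSpaces.Torus.fderiv φ) ((Φ N).flow t₁ z) (t₂ - t₁) + (∫ s in t₁..t₂, ∫ x, ((∑ i, ∑ j, (Literature.MathematicalPhysics.KineticTheory.empiricalMomentumField ((Φ N).flow s z) (fun y => k (x - y)) i * Literature.MathematicalPhysics.KineticTheory.empiricalMomentumField ((Φ N).flow s z) (fun y => k (x - y)) j / Literature.MathematicalPhysics.KineticTheory.empiricalDensityField ((Φ N).flow s z) (fun y => k (x - y))) * Literature.Analysis.FunctionSpaces.Torus.partialDeriv j (fun y => φ y i) x) + Literature.MathematicalPhysics.KineticTheory.empiricalDensityField ((Φ N).flow s z) (fun y => k (x - y)) * (2 / 3 * (Literature.MathematicalPhysics.KineticTheory.empiricalEnergyField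 ((Φ N).flow s z) (fun y => k (x - y)) / Literature.MathematicalPhysics.KineticTheory.empiricalDensityField ((Φ N).flow s z) (fun y => k (x - y)) - ‖Literature.MathematicalPhysics.KineticTheory.empiricalMomentumField ((Φ N).flow s z) (fun y => k (x - y))‖ ^ 2 / (2 * Literature.MathematicalPhysics.KineticTheory.empiricalDensityField ((Φ N).flow s z) (fun y => k (x - y)) ^ 2))) * Literature.Analysis.FunctionSpaces.Torus.divergence φ x)) - (∫ s in t₁..t₂, ∫ x, ((∑ i, ∑ j, (Literature.MathematicalPhysics.KineticTheory.empiricalMomentumField ((Φ N).flow s z) (fun y => k (x - y)) i * Literature.MathematicalPhysics.KineticTheory.empiricalMomentumField ((Φ N).flow s z) (fun y => k (x - y)) j / Literature.MathematicalPhysics.KineticTheory.empiricalDensityField ((Φ N).flow s z) (fun y => k (x - y))) * Literature.Analysis.FunctionSpaces.Torus.partialDeriv j (fun y => φ y i) x) + Literature.MathematicalPhysics.KineticTheory.hsPressure σ (Literature.MathematicalPhysics.KineticTheory.empiricalDensityField ((Φ N).flow s z) (fun y => k (x - y))) (2 / 3 * (Literature.MathematicalPhysics.KineticTheory.empiricalEnergyField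 ((Φ N).flow s z) (fun y => k (x - y)) / Literature.MathematicalPhysics.KineticTheory.empiricalDensityField ((Φ N).flow s z) (fun y => k (x - y)) - ‖Literature.MathematicalPhysics.KineticTheory.empiricalMomentumField ((Φ N).flow s z) (fun y => k (x - y))‖ ^ 2 / (2 * Literature.MathematicalPhysics.KineticTheory.empiricalDensityField ((Φ N).flow s z) (fun y => k (x - y)) ^ 2))) * Literature.Analysis.FunctionSpaces.Torus.divergence φ x))) → MeasureTheory.Integrable D (Literature.MathematicalPhysics.KineticTheory.localGibbsLaw σ (fun _ => a) (fun _ => u) (fun _ => θ) N (Φ N)) ∧ |∫ z, D z ∂Literature.MathematicalPhysics.KineticTheory.localGibbsLaw σ (fun _ => a) (fun _ => u) (fun _ => θ) N (Φ N)| ≤ ε) := by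
  intro hR a θ u ha hθ
  obtain ⟨σ₀, hσ₀, H⟩ := hR a θ u ha hθ
  refine ⟨min σ₀ (1 / 2), lt_min hσ₀ one_half_pos, ?_⟩
  intro σ hσ hσlt Φ t₁ t₂ h₁ h₁₂ ε hε φ hφ
  have hσ₁ : σ < σ₀ := hσlt.trans_le (min_le_left _ _)
  have hσ₂ : σ < 1 / 2 := hσlt.trans_le (min_le_right _ _)
  obtain ⟨ℓ, hℓ, Hk⟩ := H σ hσ hσ₁ Φ t₁ t₂ h₁ h₁₂ ε hε φ hφ
  refine ⟨ℓ, hℓ, fun k hk => ?_⟩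
  filter_upwards [Hk k hk] with N hN
  intro D hD
  subst hD
  exact integrable_and_abs_integral_le_of_add_sub
    (stub_collisionalVirialEquilibriumStress a θ u ha hθ σ hσ hσ₂ N (Φ N) t₁ t₂ h₁ h₁₂ φ hφ).1 (hN _ rfl)

open CollisionalVirialClosure in
/-- **Converse reduction `VIRIAL-const → JI-const`**: at constant profiles stub VIRIAL implies the mean closure of
`J_φ − I_φ` alone (subtract the mean-zero collisional-stress summand; threshold `min σ₀ (1/2)`). Together with
`collisionalVirialClosureConst_of_idealFullEulerStressClosureConst`: in equilibrium VIRIAL ⟺ JI. [folklore] -/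
theorem idealFullEulerStressClosureConst_of_collisionalVirialClosureConst : (∀ (a θ : ℝ) (u : Literature.MathematicalPhysics.KineticTheory.V3), 0 < a → 0 < θ → ∃ σ₀ : ℝ, 0 < σ₀ ∧ ∀ σ : ℝ, 0 < σ → σ < σ₀ → ∀ Φ : (N : ℕ) → Literature.Analysis.FluidPDE.HardSphereFlow (Literature.Analysis.FluidPDE.Torus.geometry (Fin 3)) (Literature.MathematicalPhysics.KineticTheory.hsDiameter σ N) (N + 1), ∀ t₁ t₂ : ℝ, 0 ≤ t₁ → t₁ ≤ t₂ → ∀ ε : ℝ, 0 < ε → (∀ φ : Literature.MathematicalPhysics.KineticTheory.T3 → Literature.MathematicalPhysics.KineticTheory.V3, Literature.Analysis.FunctionSpaces.Torus.IsSmooth φ → ∃ ℓ : ℝ, 0 < ℓ ∧ ∀ k : Literature.MathematicalPhysics.KineticTheory.T3 → ℝ, (Continuous k ∧ (∀ y, 0 ≤ k y) ∧ (∫ y, k y = 1) ∧ (∀ y, k y ≠ 0 → Literature.Analysis.FluidPDE.Torus.euclidDist y 0 < ℓ)) → ∀ᶠ N in Filter.atTop, ∀ D : Literature.Analysis.FluidPDE.Config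 (N + 1) (Fin 3) Literature.MathematicalPhysics.KineticTheory.T3 → ℝ, D = (fun z => ((N + 1 : ℕ) : ℝ)⁻¹ * (Φ N).collisionalStress (Literature.Analysis.FunctionSpaces.Torus.fderiv φ) ((Φ N).flow t₁ z) (t₂ - t₁) + (∫ s in t₁..t₂, ∫ x, ((∑ i, ∑ j, (Literature.MathematicalPhysics.KineticTheory.empiricalMomentumField ((Φ N).flow s z) (fun y => k (x - y)) i * Literature.MathematicalPhysics.KineticTheory.empiricalMomentumField ((Φ N).flow s z) (fun y => k (x - y)) j / Literature.MathematicalPhysics.KineticTheory.empiricalDensityField ((Φ N).flow s z) (fun y => k (x - y))) * Literature.Analysis.FunctionSpaces.Torus.partialDeriv j (fun y => φ y i) x) + Literature.MathematicalPhysics.KineticTheory.empiricalDensityField ((Φ N).flow s z) (fun y => k (x - y)) * (2 / 3 * (Literature.MathematicalPhysics.KineticTheory.empiricalEnergyField ((Φ N).flow s z) (fun y => k (x - y)) / Literature.MathematicalPhysics.KineticTheory.empiricalDensityField ((Φ N).flow s z) (fun y => k (x - y)) - ‖Literature.MathematicalPhysics.KineticTheory.empiricalMomentumField ((Φ N).flow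 s z) (fun y => k (x - y))‖ ^ 2 / (2 * Literature.MathematicalPhysics.KineticTheory.empiricalDensityField ((Φ N).flow s z) (fun y => k (x - y)) ^ 2))) * Literature.Analysis.FunctionSpaces.Torus.divergence φ x)) - (∫ s in t₁..t₂, ∫ x, ((∑ i, ∑ j, (Literature.MathematicalPhysics.KineticTheory.empiricalMomentumField ((Φ N).flow s z) (fun y => k (x - y)) i * Literature.MathematicalPhysics.KineticTheory.empiricalMomentumField ((Φ N).flow s z) (fun y => k (x - y)) j / Literature.MathematicalPhysics.KineticTheory.empiricalDensityField ((Φ N).flow s z) (fun y => k (x - y))) * Literature.Analysis.FunctionSpaces.Torus.partialDeriv j (fun y => φ y i) x) + Literature.MathematicalPhysics.KineticTheory.hsPressure σ (Literature.MathematicalPhysics.KineticTheory.empiricalDensityField ((Φ N).flow s z) (fun y => k (x - y))) (2 / 3 * (Literature.MathematicalPhysics.KineticTheory.empiricalEnergyField ((Φ N).flow s z) (fun y => k (x - y)) / Literature.MathematicalPhysics.KineticTheory.empiricalDensityField ((Φ N).flow s z) (fun y => k (x - y)) - ‖Literature.MathematicalPhysics.KineticTheory.empiricalMomentumField ((Φ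 N).flow s z) (fun y => k (x - y))‖ ^ 2 / (2 * Literature.MathematicalPhysics.KineticTheory.empiricalDensityField ((Φ N).flow s z) (fun y => k (x - y)) ^ 2))) * Literature.Analysis.FunctionSpaces.Torus.divergence φ x))) → MeasureTheory.Integrable D (Literature.MathematicalPhysics.KineticTheory.localGibbsLaw σ (fun _ => a) (fun _ => u) (fun _ => θ) N (Φ N)) ∧ |∫ z, D z ∂Literature.MathematicalPhysics.KineticTheory.localGibbsLaw σ (fun _ => a) (fun _ => u) (fun _ => θ) N (Φ N)| ≤ ε)) → ∀ (a θ : ℝ) (u : Literature.MathematicalPhysics.KineticTheory.V3), 0 < a → 0 < θ → ∃ σ₀ : ℝ, 0 < σ₀ ∧ ∀ σ : ℝ, 0 < σ → σ < σ₀ → ∀ Φ : (N : ℕ) → Literature.Analysis.FluidPDE.HardSphereFlow (Literature.Analysis.FluidPDE.Torus.geometry (Fin 3)) (Literature.MathematicalPhysics.KineticTheory.hsDiameter σ N) (N + 1), ∀ t₁ t₂ : ℝ, 0 ≤ t₁ → t₁ ≤ t₂ → ∀ ε : ℝ, 0 < ε → (∀ φ : Literature.MathematicalPhysics.KineticTheory.T3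 → Literature.MathematicalPhysics.KineticTheory.V3, Literature.Analysis.FunctionSpaces.Torus.IsSmooth φ → ∃ ℓ : ℝ, 0 < ℓ ∧ ∀ k : Literature.MathematicalPhysics.KineticTheory.T3 → ℝ, (Continuous k ∧ (∀ y, 0 ≤ k y) ∧ (∫ y, k y = 1) ∧ (∀ y, k y ≠ 0 → Literature.Analysis.FluidPDE.Torus.euclidDist y 0 < ℓ)) → ∀ᶠ N in Filter.atTop, ∀ D : Literature.Analysis.FluidPDE.Config (N + 1) (Fin 3) Literature.MathematicalPhysics.KineticTheory.T3 → ℝ, D = (fun z => (∫ s in t₁..t₂, ∫ x, ((∑ i, ∑ j, (Literature.MathematicalPhysics.KineticTheory.empiricalMomentumField ((Φ N).flow s z) (fun y => k (x - y)) i * Literature.MathematicalPhysics.KineticTheory.empiricalMomentumField ((Φ N).flow s z) (fun y => k (x - y)) j / Literature.MathematicalPhysics.KineticTheory.empiricalDensityField ((Φ N).flow s z) (fun y => k (x - y))) * Literature.Analysis.FunctionSpaces.Torus.partialDeriv j (fun y => φ y i) x) + Literature.MathematicalPhysics.KineticTheory.empiricalDensityField ((Φ N).flow s z) (fun y => k (x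 - y)) * (2 / 3 * (Literature.MathematicalPhysics.KineticTheory.empiricalEnergyField ((Φ N).flow s z) (fun y => k (x - y)) / Literature.MathematicalPhysics.KineticTheory.empiricalDensityField ((Φ N).flow s z) (fun y => k (x - y)) - ‖Literature.MathematicalPhysics.KineticTheory.empiricalMomentumField ((Φ N).flow s z) (fun y => k (x - y))‖ ^ 2 / (2 * Literature.MathematicalPhysics.KineticTheory.empiricalDensityField ((Φ N).flow s z) (fun y => k (x - y)) ^ 2))) * Literature.Analysis.FunctionSpaces.Torus.divergence φ x)) - (∫ s in t₁..t₂, ∫ x, ((∑ i, ∑ j, (Literature.MathematicalPhysics.KineticTheory.empiricalMomentumField ((Φ N).flow s z) (fun y => k (x - y)) i * Literature.MathematicalPhysics.KineticTheory.empiricalMomentumField ((Φ N).flow s z) (fun y => k (x - y)) j / Literature.MathematicalPhysics.KineticTheory.empiricalDensityField ((Φ N).flow s z) (fun y => k (x - y))) * Literature.Analysis.FunctionSpaces.Torus.partialDeriv j (fun y => φ y i) x) + Literature.MathematicalPhysics.KineticTheory.hsPressure σ (Literature.MathematicalPhysics.KineticTheory.empiricalDensityField ((Φ N).flow s z) (fun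 y => k (x - y))) (2 / 3 * (Literature.MathematicalPhysics.KineticTheory.empiricalEnergyField ((Φ N).flow s z) (fun y => k (x - y)) / Literature.MathematicalPhysics.KineticTheory.empiricalDensityField ((Φ N).flow s z) (fun y => k (x - y)) - ‖Literature.MathematicalPhysics.KineticTheory.empiricalMomentumField ((Φ N).flow s z) (fun y => k (x - y))‖ ^ 2 / (2 * Literature.MathematicalPhysics.KineticTheory.empiricalDensityField ((Φ N).flow s z) (fun y => k (x - y)) ^ 2))) * Literature.Analysis.FunctionSpaces.Torus.divergence φ x))) → MeasureTheory.Integrable D (Literature.MathematicalPhysics.KineticTheory.localGibbsLaw σ (fun _ => a) (fun _ => u) (fun _ => θ) N (Φ N)) ∧ |∫ z, D z ∂Literature.MathematicalPhysics.KineticTheory.localGibbsLaw σ (fun _ => a) (fun _ => u) (fun _ => θ) N (Φ N)| ≤ ε) := by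
  intro hV a θ u ha hθ
  obtain ⟨σ₀, hσ₀, H⟩ := hV a θ u ha hθ
  refine ⟨min σ₀ (1 / 2), lt_min hσ₀ one_half_pos, ?_⟩
  intro σ hσ hσlt Φ t₁ t₂ h₁ h₁₂ ε hε φ hφ
  have hσ₁ : σ < σ₀ := hσlt.trans_le (min_le_left _ _)
  have hσ₂ : σ < 1 / 2 := hσlt.trans_le (min_le_right _ _)
  obtain ⟨ℓ, hℓ, Hk⟩ := H σ hσ hσ₁ Φ t₁ t₂ h₁ h₁₂ ε hε φ hφ
  refine ⟨ℓ, hℓ, fun k hk => ?_⟩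
  filter_upwards [Hk k hk] with N hN
  intro D hD
  subst hD
  exact integrable_and_abs_integral_le_sub_of_add_sub
    (stub_collisionalVirialEquilibriumStress a θ u ha hθ σ hσ hσ₂ N (Φ N) t₁ t₂ h₁ h₁₂ φ hφ).1 (hN _ rfl)

end Summit.AtomisticToContinuum.HydrodynamicLimit.Theorems
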